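import Literature.Geometry.MetricEmbeddings.HeisenbergLines
import HarnessLib

/-!
# Nonconvexity, nonmonotonicity and `δ`-monotone subsets of `ℍ` ([CKN] §4, Def. 18)

Family `pnp`, layer `Literature/Geometry/MetricEmbeddings`; continues `HeisenbergLines.lean`
(horizontal lines `Λ_θ((s,w),·)` of `HeisK`, their measure `dθ ds dw`, monotone sets). Source:
J. Cheeger, B. Kleiner, A. Naor, arXiv:0910.2026 = Acta Math. 207 (2011), §4 "Stability of
monotone sets" (arXiv p. 13): "Given a ball `B_r(x) ⊂ ℍ` and `L ∈ lines(B_r(x))`, we define the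
nonconvexity of `(E,L)` on `B_r(x)` […]
`NC_{B_r(x)}(E,L) = inf { ∫_{L ∩ B_r(x)} |χ_I − χ_{E ∩ L ∩ B_r(x)}| dℋ¹_L : I ⊂ L ∩ B_r(x) subinterval }`,
where we allow in the infimum above the subinterval `I` to be empty. Similarly, we define the
nonmonotonicity of `(E,L)` on `B_r(x)` by `NM_{B_r(x)}(E,L) = NC_{B_r(x)}(E,L) + NC_{B_r(x)}(E',L)`.
The total nonconvexity and total nonmonotonicity of `E` on `B_r(x)` are defined to be the
following (scale invariant) quantities: `NC_{B_r(x)}(E) = r⁻⁴ ∫_{lines(B_r(x))} NC_{B_r(x)}(E,L) d𝒩(L)`,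
`NM_{B_r(x)}(E) = r⁻⁴ ∫_{lines(B_r(x))} NM_{B_r(x)}(E,L) d𝒩(L)`. Note that `NM_{B_r(x)}(E) = 0` if
`E` is monotone […] Definition 18. A cut `E ⊂ B_r(p) ⊂ ℍ` is said to be `δ`-monotone on `B_r(x)`
if `NM_{B_r(x)}(E) < δ`." (`𝒩` the left-invariant measure on `lines(ℍ)` with
`𝒩(lines(B_1(e))) = 1`.)

DEFINED here (real definitions): `HeisK.sliceNC A T`, `HeisK.sliceNM A T` (the one-dimensional
functionals: `inf` over open intervals `I` of `ℋ¹(T ∩ (A ∆ I))`, and its symmetrisation);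
`HeisK.lineSlice E v = {t | Λ_θ((s,w),t) ∈ E}` (`v = (θ,(s,w))`; `E ∩ L`);
`HeisK.lineNC E x r v`, `HeisK.lineNM E x r v` (`NC_{B_r(x)}(E,L)`, `NM_{B_r(x)}(E,L)`);
`HeisK.lineMeasure` (`dθ ds dw`, `θ ∈ (0,2π]`), `HeisK.linesUnitBall` (`𝒩'(lines(B_1(e)))`, the
normalisation), `HeisK.totalNC E x r`, `HeisK.totalNM E x r` (`NC_{B_r(x)}(E)`, `NM_{B_r(x)}(E)`,
with `𝒩 = 𝒩'/𝒩'(lines(B_1(e)))`), `HeisK.IsDeltaMonotone E x r δ` (Def. 18); the actions `HeisK.lineParamShift g`,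
`HeisK.lineParamDilate ρ` of left translations and dilations on line parameters (as measurable
equivalences `lineParamShiftEquiv`, `lineParamDilateEquiv`).

PROVED here (no named facts): the windows `L ∩ B_r(x)` are INTERVALS of length `< 4r`
(`ordConnected_lineSlice_ball`: the Korányi quartic is a convex quartic polynomial along horizontal
lines, `quartic_lineMap`), so the printed "subinterval `I ⊂ L ∩ B_r(x)`" agrees with the infimum
over all intervals; `sliceNM_eq_zero_of_isEssRay`, `lineNM_eq_zero_of_isEssRay`,
**`totalNM_eq_zero_of_isMonotone`** ("`NM_{B_r(x)}(E) = 0` if `E` is monotone"),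
`IsMonotone.isDeltaMonotone`, `totalNM_halfspace`; `0 < 𝒩'(lines(B_1(e))) < ∞`
(`linesUnitBall_pos`, `linesUnitBall_lt_top`), so the normalisation is non-degenerate
(`normaliser_ne_zero`, `normaliser_ne_top`); elementary bounds `sliceNM_le_volume`, `lineNM_le`;
and the INVARIANCES justifying the normalisation `r⁻⁴` ("scale invariant quantities"):
`totalNC_preimage_mul` / `totalNM_preimage_mul` (`NM_{B_r(x)}(g⁻¹E) = NM_{B_r(gx)}(E)`: the
measure on lines is left-invariant, `measurePreserving_lineParamShift_lineMeasure`) and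
`totalNC_preimage_dilate` / `totalNM_preimage_dilate` (`NM_{B_r(x)}(δ_ρ⁻¹E) = NM_{B_{ρr}(δ_ρ x)}(E)`:
`(δ_ρ)_*𝒩' = ρ⁻³𝒩'`, `map_lineParamDilate_lineMeasure`, and lengths scale by `ρ`), hence
`isDeltaMonotone_preimage_mul_iff`, `isDeltaMonotone_preimage_dilate_iff`.

NOT here: measurability of `L ↦ NC_{B_r(x)}(E,L)`, the stability theorem [CKN Thm. 19] and the
quantitative lemmas of §§7–12.

## References

* [CheegerKleinerNaor2011] J. Cheeger, B. Kleiner, A. Naor, Acta Math. 207 (2011) 291–373, §4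
  (arXiv:0910.2026 pp. 13–14), Def. 18.
* [Cygan1981] J. Cygan, Proc. AMS 83 (1981) 69–70.
-/

noncomputable section

open MeasureTheory Set Real
open scoped ENNReal

namespace Literature.Geometry.MetricEmbeddings

namespace HeisK

/-! ### Nonconvexity and nonmonotonicity of a subset of `ℝ` in a window -/

/-- **Nonconvexity of a subset `A ⊆ ℝ` in the window `T`** ([CKN §4, (dnc)] along one line):
`NC_T(A) = inf_I ℋ¹(T ∩ (A ∆ I))`, the infimum over all open intervals `I = (a, b)` (including the
empty ones; for a bounded window this is the infimum over all subintervals of `T`).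
[cite: CheegerKleinerNaor2011, §4 (arXiv p. 13)] -/
def sliceNC (A T : Set ℝ) : ℝ≥0∞ := ⨅ (a : ℝ) (b : ℝ), volume (T ∩ symmDiff A (Ioo a b))

/-- **Nonmonotonicity in the window `T`**: `NM_T(A) = NC_T(A) + NC_T(Aᶜ)` ([CKN §4, (dnm)]).
[cite: CheegerKleinerNaor2011, §4 (arXiv p. 13)] -/
def sliceNM (A T : Set ℝ) : ℝ≥0∞ := sliceNC A T + sliceNC Aᶜ T

/-- [cite: CheegerKleinerNaor2011, §4 (arXiv p. 13)] -/
theorem sliceNC_le (A T : Set ℝ) (a b : ℝ) : sliceNC A T ≤ volume (T ∩ symmDiff A (Ioo a b)) :=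
  (iInf_le _ a).trans (iInf_le _ b)

/-- `NC_T(A) ≤ ℋ¹(T ∩ A)` (take `I = ∅`). [cite: CheegerKleinerNaor2011, §4 (arXiv p. 13)] -/
theorem sliceNC_le_volume_inter (A T : Set ℝ) : sliceNC A T ≤ volume (T ∩ A) := by
  have h := sliceNC_le A T 0 0
  rwa [Ioo_self, show symmDiff A (∅ : Set ℝ) = A from symmDiff_bot A] at h

/-- `NC_T(A) ≤ ℋ¹(T)`. [cite: CheegerKleinerNaor2011, §4 (arXiv p. 13)] -/
theorem sliceNC_le_volume (A T : Set ℝ) : sliceNC A T ≤ volume T :=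
  (sliceNC_le_volume_inter A T).trans (measure_mono inter_subset_left)

/-- `NM_T(A) ≤ ℋ¹(T ∩ A) + ℋ¹(T ∩ Aᶜ) = ℋ¹(T)` for measurable `A`.
[cite: CheegerKleinerNaor2011, §4 (arXiv p. 13)] -/
theorem sliceNM_le_volume {A : Set ℝ} (hA : MeasurableSet A) (T : Set ℝ) : sliceNM A T ≤ volume T := by
  calc sliceNM A T ≤ volume (T ∩ A) + volume (T ∩ Aᶜ) :=
        add_le_add (sliceNC_le_volume_inter A T) (sliceNC_le_volume_inter Aᶜ T)
    _ = volume T := by rw [← measure_inter_add_sdiff T hA, sdiff_eq]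

/-- `NM` is symmetric under complementation. [cite: CheegerKleinerNaor2011, §4 (arXiv p. 13)] -/
theorem sliceNM_compl (A T : Set ℝ) : sliceNM Aᶜ T = sliceNM A T := by
  rw [sliceNM, sliceNM, compl_compl, add_comm]

/-- Changing `A` by a set that is null in the window does not change `NC_T(A)`.
[cite: CheegerKleinerNaor2011, §4 (arXiv p. 13)] -/
theorem sliceNC_le_of_null {A B T : Set ℝ} (h : volume (T ∩ symmDiff A B) = 0) :
    sliceNC B T ≤ sliceNC A T := by
  refine le_iInf₂ fun a b => (sliceNC_le B T a b).trans ?_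
  calc volume (T ∩ symmDiff B (Ioo a b))
      ≤ volume (T ∩ symmDiff A B ∪ T ∩ symmDiff A (Ioo a b)) := by
        refine measure_mono fun t ht => ?_
        have tri := symmDiff_triangle B A (Ioo a b)
        rcases tri (show t ∈ symmDiff B (Ioo a b) from ht.2) with h1 | h1
        · exact Or.inl ⟨ht.1, by rwa [symmDiff_comm]⟩
        · exact Or.inr ⟨ht.1, h1⟩
    _ ≤ volume (T ∩ symmDiff A B) + volume (T ∩ symmDiff A (Ioo a b)) := measure_union_le _ _
    _ = volume (T ∩ symmDiff A (Ioo a b)) := by rw [h, zero_add]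

/-- [cite: CheegerKleinerNaor2011, §4 (arXiv p. 13)] -/
theorem sliceNC_congr_null {A B T : Set ℝ} (h : volume (T ∩ symmDiff A B) = 0) :
    sliceNC A T = sliceNC B T :=
  le_antisymm (sliceNC_le_of_null (by rwa [symmDiff_comm])) (sliceNC_le_of_null h)

/-- [cite: CheegerKleinerNaor2011, §4 (arXiv p. 13)] -/
theorem sliceNM_congr_null {A B T : Set ℝ} (h : volume (T ∩ symmDiff A B) = 0) :
    sliceNM A T = sliceNM B T := by
  rw [sliceNM, sliceNM, sliceNC_congr_null h, sliceNC_congr_null (A := Aᶜ) (B := Bᶜ)]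
  rwa [compl_symmDiff_compl]

/-- The window is monotone: `T ⊆ T' ⇒ NC_T ≤ NC_{T'}`. [cite: CheegerKleinerNaor2011, §4 (arXiv p. 13)] -/
theorem sliceNC_mono {A T T' : Set ℝ} (h : T ⊆ T') : sliceNC A T ≤ sliceNC A T' :=
  le_iInf₂ fun a b => (sliceNC_le A T a b).trans (measure_mono (inter_subset_inter_left _ h))

/-- **Rays have vanishing nonconvexity in bounded windows**: if `A` is a ray and
`T ⊆ (a₀, b₀)`, then `NC_T(A) = 0`. [cite: CheegerKleinerNaor2011, §4 (arXiv p. 13)] -/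
theorem sliceNC_eq_zero_of_isRay {R T : Set ℝ} (hR : IsRay R) {a₀ b₀ : ℝ} (hT : T ⊆ Ioo a₀ b₀) :
    sliceNC R T = 0 := by
  -- in each case exhibit an interval `I` with `T ∩ (R ∆ I)` empty or a single point
  refine nonpos_iff_eq_zero.mp ?_
  rcases hR with rfl | rfl | ⟨c, rfl | rfl | rfl | rfl⟩
  · refine (sliceNC_le _ T 0 0).trans (le_of_eq ?_)
    rw [Ioo_self, show symmDiff (∅ : Set ℝ) (∅ : Set ℝ) = ∅ from symmDiff_bot _, inter_empty, measure_empty]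
  · refine (sliceNC_le _ T a₀ b₀).trans (le_of_eq (measure_mono_null (fun t ht => ?_) measure_empty))
    rcases ht with ⟨hT', hd⟩
    rw [Set.mem_symmDiff] at hd
    rcases hd with ⟨-, hn⟩ | ⟨-, hn⟩
    · exact hn (hT hT')
    · exact hn trivial
  · -- `R = (-∞, c)`: take `I = (a₀, c)`
    refine (sliceNC_le _ T a₀ c).trans (le_of_eq (measure_mono_null (fun t ht => ?_) measure_empty))
    rcases ht with ⟨hT', hd⟩
    have h1 := hT hT'
    rw [Set.mem_symmDiff] at hd
    rcases hd with ⟨hc, hn⟩ | ⟨hI, hn⟩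
    · exact hn ⟨h1.1, hc⟩
    · exact hn hI.2
  · -- `R = (c, ∞)`: take `I = (c, b₀)`
    refine (sliceNC_le _ T c b₀).trans (le_of_eq (measure_mono_null (fun t ht => ?_) measure_empty))
    rcases ht with ⟨hT', hd⟩
    have h1 := hT hT'
    rw [Set.mem_symmDiff] at hd
    rcases hd with ⟨hc, hn⟩ | ⟨hI, hn⟩
    · exact hn ⟨hc, h1.2⟩
    · exact hn hI.1
  · -- `R = (-∞, c]`: take `I = (a₀, c)`; the difference is within `{c}`
    refine (sliceNC_le _ T a₀ c).trans (le_of_eq (measure_mono_null (fun t ht => ?_)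
      (Real.volume_singleton (a := c))))
    rcases ht with ⟨hT', hd⟩
    have h1 := hT hT'
    rw [Set.mem_symmDiff] at hd
    rw [mem_singleton_iff]
    rcases hd with ⟨hc, hn⟩ | ⟨hI, hn⟩
    · by_contra hne
      exact hn ⟨h1.1, lt_of_le_of_ne hc hne⟩
    · exact absurd hI.2.le hn
  · -- `R = [c, ∞)`: take `I = (c, b₀)`
    refine (sliceNC_le _ T c b₀).trans (le_of_eq (measure_mono_null (fun t ht => ?_)
      (Real.volume_singleton (a := c))))
    rcases ht with ⟨hT', hd⟩
    have h1 := hT hT'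
    rw [Set.mem_symmDiff] at hd
    rw [mem_singleton_iff]
    rcases hd with ⟨hc, hn⟩ | ⟨hI, hn⟩
    · by_contra hne
      exact hn ⟨lt_of_le_of_ne hc (Ne.symm hne), h1.2⟩
    · exact absurd hI.1.le hn

/-- **Essential rays have vanishing nonmonotonicity in bounded windows** ("Note that
`NM_{B_r(x)}(E) = 0` if `E` is monotone", [CKN §4]). [cite: CheegerKleinerNaor2011, §4 (arXiv p. 13)] -/
theorem sliceNM_eq_zero_of_isEssRay {A T : Set ℝ} (hA : IsEssRay A) {a₀ b₀ : ℝ}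
    (hT : T ⊆ Ioo a₀ b₀) : sliceNM A T = 0 := by
  obtain ⟨R, hR, h0⟩ := hA
  have hT0 : volume (T ∩ symmDiff A R) = 0 := measure_mono_null inter_subset_right h0
  rw [sliceNM_congr_null hT0, sliceNM, sliceNC_eq_zero_of_isRay hR hT,
    sliceNC_eq_zero_of_isRay hR.compl hT, add_zero]

/-! ### Slices and windows of horizontal lines -/

/-- The **slice** of `E ⊆ ℍ` along the horizontal line with parameters `v = (θ, (s, w))`:
the set of arc-length parameters `{t | Λ_θ((s,w),t) ∈ E}` (`= E ∩ L` in [CKN]).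
[cite: CheegerKleinerNaor2011, §4 (arXiv p. 13)] -/
def lineSlice (E : Set HeisK) (v : ℝ × ℝ × ℝ) : Set ℝ := {t | lineMap v.1 (v.2, t) ∈ E}

/-- [cite: CheegerKleinerNaor2011, §4 (arXiv p. 13)] -/
@[simp] theorem mem_lineSlice (E : Set HeisK) (v : ℝ × ℝ × ℝ) (t : ℝ) :
    t ∈ lineSlice E v ↔ lineMap v.1 (v.2, t) ∈ E := Iff.rfl

/-- [cite: CheegerKleinerNaor2011, §4 (arXiv p. 13)] -/
theorem lineSlice_compl (E : Set HeisK) (v : ℝ × ℝ × ℝ) : lineSlice Eᶜ v = (lineSlice E v)ᶜ := rfl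

/-- [cite: CheegerKleinerNaor2011, §4 (arXiv p. 13)] -/
theorem lineSlice_inter (E F : Set HeisK) (v : ℝ × ℝ × ℝ) :
    lineSlice (E ∩ F) v = lineSlice E v ∩ lineSlice F v := rfl

/-- Slices of measurable sets are measurable. [cite: CheegerKleinerNaor2011, §4 (arXiv p. 13)] -/
theorem measurableSet_lineSlice {E : Set HeisK} (hE : MeasurableSet E) (v : ℝ × ℝ × ℝ) :
    MeasurableSet (lineSlice E v) :=
  hE.preimage ((measurable_lineMap v.1).comp (measurable_const.prodMk measurable_id))

/-- The monotone sets are those whose slices are a.e. essential rays (definitional).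
[cite: CheegerKleinerNaor2011, §2 (arXiv p. 7)] -/
theorem isMonotone_iff (E : Set HeisK) : IsMonotone E ↔ ∀ᵐ v : ℝ × (ℝ × ℝ), IsEssRay (lineSlice E v) :=
  Iff.rfl

/-- The Cygan–Korányi quartic along a horizontal line is the convex quartic polynomial
`Q(Λ_θ((s,w),t)) = (s² + t²)² + 4(c₀ − st)²`, `c₀ = 2w + s² sin θ cos θ`.
[cite: Cygan1981, p. 69] -/
theorem quartic_lineMap (θ s w t : ℝ) :
    quartic (lineMap θ ((s, w), t)) =
      (s ^ 2 + t ^ 2) ^ 2 + 4 * ((2 * w + s ^ 2 * Real.sin θ * Real.cos θ) - s * t) ^ 2 := by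
  rw [quartic_eq_ckn, ckn_lineMap]
  have h := Real.sin_sq_add_cos_sq θ
  simp only
  have e : (-s * Real.sin θ + t * Real.cos θ) ^ 2 + (s * Real.cos θ + t * Real.sin θ) ^ 2 =
      s ^ 2 + t ^ 2 := by
    linear_combination (s ^ 2 + t ^ 2) * h
  rw [e]

/-- `t ↦ Q(Λ_θ((s,w),t))` is convex. [cite: Cygan1981, p. 69] -/
theorem convexOn_quartic_lineMap (θ s w : ℝ) :
    ConvexOn ℝ univ fun t : ℝ => quartic (lineMap θ ((s, w), t)) := by
  set c₀ : ℝ := 2 * w + s ^ 2 * Real.sin θ * Real.cos θ with hc₀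
  have e : (fun t : ℝ => quartic (lineMap θ ((s, w), t))) =
      fun t : ℝ => t ^ 4 + (6 * s ^ 2) • t ^ 2 + (-(8 * c₀ * s) * t + (s ^ 4 + 4 * c₀ ^ 2)) := by
    funext t
    rw [quartic_lineMap, smul_eq_mul]
    ring
  rw [e]
  have h4 : ConvexOn ℝ univ fun t : ℝ => t ^ 4 := Even.convexOn_pow (by decide)
  have h2 : ConvexOn ℝ univ fun t : ℝ => (6 * s ^ 2) • t ^ 2 :=
    (Even.convexOn_pow (by decide)).smul (by positivity)
  have haff : ConvexOn ℝ univ fun t : ℝ => -(8 * c₀ * s) * t + (s ^ 4 + 4 * c₀ ^ 2) := by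
    refine ⟨convex_univ, fun x _ y _ p q _ _ hpq => le_of_eq ?_⟩
    simp only [smul_eq_mul]
    linear_combination (-(s ^ 4 + 4 * c₀ ^ 2)) * hpq
  exact (h4.add h2).add haff

/-- **Horizontal lines meet Korányi balls in intervals** (about the identity): the window
`{t | Λ_θ((s,w),t) ∈ B_r(1)}` is order-connected. [cite: CheegerKleinerNaor2011, §4 (arXiv p. 13)] -/
theorem ordConnected_lineSlice_ball_one (r θ s w : ℝ) :
    (lineSlice (Metric.ball (1 : HeisK) r) (θ, (s, w))).OrdConnected := by
  rcases le_or_gt r 0 with hr | hr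
  · have : lineSlice (Metric.ball (1 : HeisK) r) (θ, (s, w)) = ∅ := by
      ext t
      simp only [mem_lineSlice, Metric.mem_ball, mem_empty_iff_false, iff_false, not_lt]
      exact hr.trans dist_nonneg
    rw [this]
    exact Set.ordConnected_empty
  · have hconv := (convexOn_quartic_lineMap θ s w).convex_lt (r ^ 4)
    have e : lineSlice (Metric.ball (1 : HeisK) r) (θ, (s, w)) =
        {t ∈ (univ : Set ℝ) | quartic (lineMap θ ((s, w), t)) < r ^ 4} := by
      ext t
      simp only [mem_lineSlice, Metric.mem_ball, mem_setOf_eq, mem_univ, true_and]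
      rw [dist_comm, dist_one_left, ← gauge_pow_four]
      constructor
      · intro h
        exact pow_lt_pow_left₀ h (gauge_nonneg _) (by norm_num)
      · intro h
        exact lt_of_pow_lt_pow_left₀ 4 hr.le h
    rw [e]
    exact (convex_iff_ordConnected.mp hconv)

/-- Slices of left translates: `{t | Λ_θ((s,w),t) ∈ g⁻¹E}` is a translate of a slice of `E`.
[cite: CheegerKleinerNaor2011, §4 (arXiv p. 13)] -/
theorem lineSlice_preimage_mul (g : HeisK) (E : Set HeisK) (θ s w : ℝ) :
    lineSlice ((fun p => g * p) ⁻¹' E) (θ, (s, w)) =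
      (fun t => (g.x * Real.cos θ + g.y * Real.sin θ) + t) ⁻¹'
        lineSlice E (θ, (s + (-g.x * Real.sin θ + g.y * Real.cos θ),
          w + s * (g.x * Real.cos θ + (g.x * Real.cos θ + g.y * Real.sin θ) * Real.sin θ ^ 2) +
            (g.z - Real.cos θ * Real.sin θ * (g.x * Real.cos θ + g.y * Real.sin θ) ^ 2 / 2 +
              (-g.x * Real.sin θ + g.y * Real.cos θ) * (g.x * Real.cos θ + g.y * Real.sin θ) *
                Real.sin θ ^ 2))) := by
  ext t
  simp only [mem_lineSlice, mem_preimage]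
  rw [mul_lineMap]

/-- **Horizontal lines meet Korányi balls in intervals**: every window
`{t | Λ_θ((s,w),t) ∈ B_r(x)}` is order-connected (so the "subintervals `I ⊂ L ∩ B_r(x)`" of
[CKN §4, (dnc)] make sense). [cite: CheegerKleinerNaor2011, §4 (arXiv p. 13)] -/
theorem ordConnected_lineSlice_ball (x : HeisK) (r θ s w : ℝ) :
    (lineSlice (Metric.ball x r) (θ, (s, w))).OrdConnected := by
  have e : Metric.ball x r = (fun p => x⁻¹ * p) ⁻¹' Metric.ball (1 : HeisK) r := by
    ext p
    simp only [Metric.mem_ball, mem_preimage]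
    rw [← dist_mul_left x⁻¹ p x, inv_mul_cancel]
  rw [e, lineSlice_preimage_mul]
  refine ⟨fun a ha b hb t ht => ?_⟩
  have hW := ordConnected_lineSlice_ball_one r θ
    (s + (-x⁻¹.x * Real.sin θ + x⁻¹.y * Real.cos θ))
    (w + s * (x⁻¹.x * Real.cos θ + (x⁻¹.x * Real.cos θ + x⁻¹.y * Real.sin θ) * Real.sin θ ^ 2) +
      (x⁻¹.z - Real.cos θ * Real.sin θ * (x⁻¹.x * Real.cos θ + x⁻¹.y * Real.sin θ) ^ 2 / 2 +
        (-x⁻¹.x * Real.sin θ + x⁻¹.y * Real.cos θ) * (x⁻¹.x * Real.cos θ + x⁻¹.y * Real.sin θ) *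
          Real.sin θ ^ 2))
  exact hW.out ha hb ⟨by simpa using ht.1, by simpa using ht.2⟩

/-- Windows are short: two parameters in the window of `B_r(x)` differ by less than `2r`.
[cite: CheegerKleinerNaor2011, §4 (arXiv p. 13)] -/
theorem abs_sub_lt_of_mem_lineSlice_ball {x : HeisK} {r θ s w t t' : ℝ}
    (ht : t ∈ lineSlice (Metric.ball x r) (θ, (s, w)))
    (ht' : t' ∈ lineSlice (Metric.ball x r) (θ, (s, w))) : |t - t'| < 2 * r := by
  simp only [mem_lineSlice, Metric.mem_ball] at ht ht'
  rw [← dist_lineMap θ s w t t']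
  have := dist_triangle (lineMap θ ((s, w), t)) x (lineMap θ ((s, w), t'))
  rw [dist_comm x] at this
  linarith

/-- Windows are bounded: the window of `B_r(x)` lies in an open interval of length `4r`.
[cite: CheegerKleinerNaor2011, §4 (arXiv p. 13)] -/
theorem exists_lineSlice_ball_subset_Ioo (x : HeisK) (r θ s w : ℝ) :
    ∃ a₀ b₀ : ℝ, lineSlice (Metric.ball x r) (θ, (s, w)) ⊆ Ioo a₀ b₀ := by
  rcases (lineSlice (Metric.ball x r) (θ, (s, w))).eq_empty_or_nonempty with h | ⟨t₀, ht₀⟩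
  · exact ⟨0, 1, by rw [h]; exact empty_subset _⟩
  · refine ⟨t₀ - 2 * r, t₀ + 2 * r, fun t ht => ?_⟩
    have h := abs_sub_lt_of_mem_lineSlice_ball ht ht₀
    rw [abs_lt] at h
    exact ⟨by linarith, by linarith⟩

/-! ### Nonconvexity and nonmonotonicity of `E ⊆ ℍ` along a line and in total; `δ`-monotone sets -/

/-- **Nonconvexity of `(E, L)` on `B_r(x)`** ([CKN §4, (dnc)]):
`NC_{B_r(x)}(E, L) = inf { ∫_{L ∩ B_r(x)} |χ_I − χ_{E ∩ L ∩ B_r(x)}| dℋ¹_L : I ⊂ L ∩ B_r(x) subinterval }`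
for the line `L = Λ_θ((s,w),·)`, `v = (θ, (s, w))`. [cite: CheegerKleinerNaor2011, §4 (arXiv p. 13)] -/
def lineNC (E : Set HeisK) (x : HeisK) (r : ℝ) (v : ℝ × ℝ × ℝ) : ℝ≥0∞ :=
  sliceNC (lineSlice E v) (lineSlice (Metric.ball x r) v)

/-- **Nonmonotonicity of `(E, L)` on `B_r(x)`** ([CKN §4, (dnm)]):
`NM_{B_r(x)}(E, L) = NC_{B_r(x)}(E, L) + NC_{B_r(x)}(E', L)`.
[cite: CheegerKleinerNaor2011, §4 (arXiv p. 13)] -/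
def lineNM (E : Set HeisK) (x : HeisK) (r : ℝ) (v : ℝ × ℝ × ℝ) : ℝ≥0∞ :=
  lineNC E x r v + lineNC Eᶜ x r v

/-- [cite: CheegerKleinerNaor2011, §4 (arXiv p. 13)] -/
theorem lineNM_eq_sliceNM (E : Set HeisK) (x : HeisK) (r : ℝ) (v : ℝ × ℝ × ℝ) :
    lineNM E x r v = sliceNM (lineSlice E v) (lineSlice (Metric.ball x r) v) := rfl

/-- [cite: CheegerKleinerNaor2011, §4 (arXiv p. 13)] -/
theorem lineNM_compl (E : Set HeisK) (x : HeisK) (r : ℝ) (v : ℝ × ℝ × ℝ) :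
    lineNM Eᶜ x r v = lineNM E x r v := by
  rw [lineNM, lineNM, compl_compl, add_comm]

/-- `NM_{B_r(x)}(E, L) ≤ ℋ¹(L ∩ B_r(x))` for measurable `E`. [cite: CheegerKleinerNaor2011, §4 (arXiv p. 13)] -/
theorem lineNM_le {E : Set HeisK} (hE : MeasurableSet E) (x : HeisK) (r : ℝ) (v : ℝ × ℝ × ℝ) :
    lineNM E x r v ≤ volume (lineSlice (Metric.ball x r) v) :=
  sliceNM_le_volume (measurableSet_lineSlice hE v) _

/-- **`NM_{B_r(x)}(E, L) = 0` when `E ∩ L` is essentially a sub-ray** ("`NM_{B_r(x)}(E) = 0` if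
`E` is monotone", [CKN §4]). [cite: CheegerKleinerNaor2011, §4 (arXiv p. 13)] -/
theorem lineNM_eq_zero_of_isEssRay {E : Set HeisK} (x : HeisK) (r : ℝ) {v : ℝ × ℝ × ℝ}
    (h : IsEssRay (lineSlice E v)) : lineNM E x r v = 0 := by
  obtain ⟨θ, s, w⟩ := v
  obtain ⟨a₀, b₀, hT⟩ := exists_lineSlice_ball_subset_Ioo x r θ s w
  exact sliceNM_eq_zero_of_isEssRay h hT

/-- **The measure `𝒩` on oriented horizontal lines**, un-normalised: `dθ ds dw` on the parameters
`(θ, (s, w))` with `θ ∈ (0, 2π]` (each oriented horizontal line exactly once); it is invariant under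
left translations (`measurePreserving_lineParamShift`). [cite: CheegerKleinerNaor2011, §4 (arXiv p. 13)] -/
def lineMeasure : Measure (ℝ × ℝ × ℝ) :=
  volume.restrict (Set.Ioc 0 (2 * Real.pi) ×ˢ (univ : Set (ℝ × ℝ)))

/-- The normalising constant `𝒩'(lines(B_1(e)))`: the (un-normalised) measure of the set of
horizontal lines meeting the unit ball (so that `𝒩 = 𝒩'/𝒩'(lines(B_1(e)))` satisfies
`𝒩(lines(B_1(e))) = 1`, [CKN §4, (Nnorm)]). [cite: CheegerKleinerNaor2011, §4 (arXiv p. 13)] -/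
def linesUnitBall : ℝ≥0∞ := lineMeasure {v | (lineSlice (Metric.ball (1 : HeisK) 1) v).Nonempty}

/-- **Total nonconvexity of `E` on `B_r(x)`** ([CKN §4, (dncm)]):
`NC_{B_r(x)}(E) = r⁻⁴ ∫_{lines(B_r(x))} NC_{B_r(x)}(E, L) d𝒩(L)` (lines missing the ball
contribute `0`; `𝒩` normalised by `𝒩(lines(B_1(e))) = 1`). [cite: CheegerKleinerNaor2011, §4 (arXiv p. 13)] -/
def totalNC (E : Set HeisK) (x : HeisK) (r : ℝ) : ℝ≥0∞ :=
  (ENNReal.ofReal (r ^ 4) * linesUnitBall)⁻¹ * ∫⁻ v, lineNC E x r v ∂lineMeasure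

/-- **Total nonmonotonicity of `E` on `B_r(x)`** ([CKN §4, (dnmm)]):
`NM_{B_r(x)}(E) = r⁻⁴ ∫ NM_{B_r(x)}(E, L) d𝒩(L) = NC_{B_r(x)}(E) + NC_{B_r(x)}(E')`.
[cite: CheegerKleinerNaor2011, §4 (arXiv p. 13)] -/
def totalNM (E : Set HeisK) (x : HeisK) (r : ℝ) : ℝ≥0∞ := totalNC E x r + totalNC Eᶜ x r

/-- **`δ`-monotone sets** ([CKN §4, Def. 18]): `E` is `δ`-monotone on `B_r(x)` if
`NM_{B_r(x)}(E) < δ`. [cite: CheegerKleinerNaor2011, §4 Def. 18 (arXiv p. 13)] -/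
def IsDeltaMonotone (E : Set HeisK) (x : HeisK) (r δ : ℝ) : Prop :=
  totalNM E x r < ENNReal.ofReal δ

/-- [cite: CheegerKleinerNaor2011, §4 (arXiv p. 13)] -/
theorem totalNM_compl (E : Set HeisK) (x : HeisK) (r : ℝ) : totalNM Eᶜ x r = totalNM E x r := by
  rw [totalNM, totalNM, compl_compl, add_comm]

/-- `NM_{B_r(x)}(E) = r⁻⁴ 𝒩(lines B_1)⁻¹ ∫ NM_{B_r(x)}(E, L)` as a single integral.
[cite: CheegerKleinerNaor2011, §4 (arXiv p. 13)] -/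
theorem totalNM_eq_lintegral (E : Set HeisK) (x : HeisK) (r : ℝ)
    (hm : Measurable (lineNC E x r)) :
    totalNM E x r =
      (ENNReal.ofReal (r ^ 4) * linesUnitBall)⁻¹ * ∫⁻ v, lineNM E x r v ∂lineMeasure := by
  rw [totalNM, totalNC, totalNC, ← mul_add, ← lintegral_add_left hm]
  rfl

/-- **Monotone sets have vanishing total nonmonotonicity on every ball** ("Note that
`NM_{B_r(x)}(E) = 0` if `E` is monotone, or more generally if the symmetric difference of `E` and
some monotone subset has measure zero", [CKN §4]). [cite: CheegerKleinerNaor2011, §4 (arXiv p. 13)] -/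
theorem totalNM_eq_zero_of_isMonotone {E : Set HeisK} (hE : IsMonotone E) (x : HeisK) (r : ℝ) :
    totalNM E x r = 0 := by
  have key : ∀ F : Set HeisK, IsMonotone F → totalNC F x r = 0 := by
    intro F hF
    have hae : ∀ᵐ v ∂lineMeasure, lineNC F x r v = 0 := by
      have h1 : ∀ᵐ v ∂(volume : Measure (ℝ × ℝ × ℝ)), lineNC F x r v = 0 := by
        filter_upwards [hF] with v hv
        have h := lineNM_eq_zero_of_isEssRay x r hv
        rw [lineNM] at h
        exact (add_eq_zero.mp h).1
      exact ae_restrict_of_ae h1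
    rw [totalNC, lintegral_congr_ae hae, lintegral_zero, mul_zero]
  rw [totalNM, key E hE, key Eᶜ hE.compl, add_zero]

/-- Monotone sets are `δ`-monotone on every ball for every `δ > 0`.
[cite: CheegerKleinerNaor2011, §4 Def. 18 (arXiv p. 13)] -/
theorem IsMonotone.isDeltaMonotone {E : Set HeisK} (hE : IsMonotone E) (x : HeisK) (r : ℝ) {δ : ℝ}
    (hδ : 0 < δ) : IsDeltaMonotone E x r δ := by
  rw [IsDeltaMonotone, totalNM_eq_zero_of_isMonotone hE]
  exact ENNReal.ofReal_pos.mpr hδ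

/-- Half-spaces have vanishing total nonmonotonicity. [cite: CheegerKleinerNaor2011, §4 (arXiv p. 14)] -/
theorem totalNM_halfspace (α β γ c₀ : ℝ) (x : HeisK) (r : ℝ) : totalNM (halfspace α β γ c₀) x r = 0 :=
  totalNM_eq_zero_of_isMonotone (isMonotone_halfspace α β γ c₀) x r

/-! ### The normalising constant is positive and finite -/

/-- Lines through points close to the identity meet the unit ball: the parameters
`θ ∈ (0, 2π]`, `|s| < 1/4`, `|w| < 1/64` give lines meeting `B_1(1)` (at `t = 0`).
[cite: CheegerKleinerNaor2011, §4 (arXiv p. 13)] -/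
theorem lineSlice_unitBall_nonempty_of_small {θ s w : ℝ} (hs : |s| < 1 / 4) (hw : |w| < 1 / 64) :
    (lineSlice (Metric.ball (1 : HeisK) 1) (θ, (s, w))).Nonempty := by
  refine ⟨0, ?_⟩
  simp only [mem_lineSlice, Metric.mem_ball]
  rw [dist_comm, dist_one_left]
  have hq : quartic (lineMap θ ((s, w), 0)) < 1 := by
    rw [quartic_lineMap]
    have h1 : s ^ 2 < 1 / 16 := by
      have := abs_lt.mp hs; nlinarith
    have hsc : |Real.sin θ * Real.cos θ| ≤ 1 := by
      rw [abs_mul]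
      exact mul_le_one₀ (Real.abs_sin_le_one θ) (abs_nonneg _) (Real.abs_cos_le_one θ)
    have h2 : |s ^ 2 * Real.sin θ * Real.cos θ| ≤ 1 / 16 := by
      rw [mul_assoc, abs_mul, abs_of_nonneg (sq_nonneg s)]
      nlinarith [abs_nonneg (Real.sin θ * Real.cos θ)]
    have h3 : |2 * w + s ^ 2 * Real.sin θ * Real.cos θ| ≤ 1 / 8 := by
      have := abs_add_le (2 * w) (s ^ 2 * Real.sin θ * Real.cos θ)
      rw [abs_mul, abs_two] at this
      linarith
    have h4 : (2 * w + s ^ 2 * Real.sin θ * Real.cos θ - s * 0) ^ 2 ≤ (1 / 8) ^ 2 := by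
      rw [mul_zero, sub_zero, ← sq_abs]
      exact pow_le_pow_left₀ (abs_nonneg _) h3 2
    nlinarith
  have h4 : gauge (lineMap θ ((s, w), 0)) ^ 4 < 1 ^ 4 := by
    rw [gauge_pow_four, one_pow]; exact hq
  exact lt_of_pow_lt_pow_left₀ 4 zero_le_one h4

/-- `0 < 𝒩'(lines(B_1(e)))`. [cite: CheegerKleinerNaor2011, §4 (arXiv p. 13)] -/
theorem linesUnitBall_pos : 0 < linesUnitBall := by
  have hsub : Set.Ioc 0 (2 * Real.pi) ×ˢ (Ioo (-(1 / 4 : ℝ)) (1 / 4) ×ˢ Ioo (-(1 / 64 : ℝ)) (1 / 64)) ⊆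
      {v : ℝ × ℝ × ℝ | (lineSlice (Metric.ball (1 : HeisK) 1) v).Nonempty} ∩
        Set.Ioc 0 (2 * Real.pi) ×ˢ (univ : Set (ℝ × ℝ)) := by
    rintro ⟨θ, s, w⟩ ⟨hθ, hs, hw⟩
    refine ⟨lineSlice_unitBall_nonempty_of_small (abs_lt.mpr hs) (abs_lt.mpr hw), hθ, trivial⟩
  rw [linesUnitBall, lineMeasure, Measure.restrict_apply' (measurableSet_Ioc.prod MeasurableSet.univ)]
  refine lt_of_lt_of_le ?_ (measure_mono hsub)
  rw [Measure.volume_eq_prod, Measure.prod_prod, Measure.volume_eq_prod, Measure.prod_prod,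
    Real.volume_Ioc, Real.volume_Ioo, Real.volume_Ioo]
  have hπ : 0 < 2 * Real.pi - 0 := by linarith [Real.pi_pos]
  positivity

/-- A line meeting `B_1(1)` has parameters `|s| < 1`, `|w| < 3`.
[cite: CheegerKleinerNaor2011, §4 (arXiv p. 13)] -/
theorem param_bounds_of_lineSlice_unitBall_nonempty {θ s w : ℝ}
    (h : (lineSlice (Metric.ball (1 : HeisK) 1) (θ, (s, w))).Nonempty) : |s| < 1 ∧ |w| < 3 := by
  obtain ⟨t, ht⟩ := h
  simp only [mem_lineSlice, Metric.mem_ball] at ht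
  rw [dist_comm, dist_one_left] at ht
  set p := lineMap θ ((s, w), t) with hp
  have hg := gauge_nonneg p
  have hq : quartic p < 1 := by
    rw [← gauge_pow_four]
    calc gauge p ^ 4 < 1 ^ 4 := pow_lt_pow_left₀ ht hg (by norm_num)
      _ = 1 := one_pow 4
  rw [hp, quartic_lineMap] at hq
  have hst : s ^ 2 + t ^ 2 < 1 := by
    by_contra hcon
    rw [not_lt] at hcon
    have : (1 : ℝ) ≤ (s ^ 2 + t ^ 2) ^ 2 := by nlinarith
    nlinarith [sq_nonneg ((2 * w + s ^ 2 * Real.sin θ * Real.cos θ) - s * t)]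
  have hs : |s| < 1 := by
    rw [← sq_lt_one_iff_abs_lt_one]
    nlinarith [sq_nonneg t]
  have ht1 : |t| < 1 := by
    rw [← sq_lt_one_iff_abs_lt_one]
    nlinarith [sq_nonneg s]
  refine ⟨hs, ?_⟩
  -- `|c₀ − st| < 1/2`, `|s t| ≤ 1/2`, `|s² sin θ cos θ| ≤ 1`
  have hc : (2 * w + s ^ 2 * Real.sin θ * Real.cos θ - s * t) ^ 2 < 1 / 4 := by
    nlinarith [sq_nonneg (s ^ 2 + t ^ 2)]
  have hX1 : 2 * w + s ^ 2 * Real.sin θ * Real.cos θ - s * t < 1 / 2 := by nlinarith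
  have hX2 : -(1 / 2) < 2 * w + s ^ 2 * Real.sin θ * Real.cos θ - s * t := by nlinarith
  have hsc : |Real.sin θ * Real.cos θ| ≤ 1 := by
    rw [abs_mul]
    exact mul_le_one₀ (Real.abs_sin_le_one θ) (abs_nonneg _) (Real.abs_cos_le_one θ)
  obtain ⟨hsc1, hsc2⟩ := abs_le.mp hsc
  have hs2 : s ^ 2 < 1 := by nlinarith [sq_nonneg t]
  have e1 : s ^ 2 * (Real.sin θ * Real.cos θ) ≤ s ^ 2 * 1 :=
    mul_le_mul_of_nonneg_left hsc2 (sq_nonneg s)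
  have e2 : s ^ 2 * (-1) ≤ s ^ 2 * (Real.sin θ * Real.cos θ) :=
    mul_le_mul_of_nonneg_left hsc1 (sq_nonneg s)
  have e3 : s * t ≤ 1 / 2 := by nlinarith [sq_nonneg (s - t)]
  have e4 : -(1 / 2) ≤ s * t := by nlinarith [sq_nonneg (s + t)]
  rw [abs_lt]
  constructor <;> nlinarith

/-- `𝒩'(lines(B_1(e))) < ∞`: the lines meeting the unit ball have parameters in a bounded box.
[cite: CheegerKleinerNaor2011, §4 (arXiv p. 13)] -/
theorem linesUnitBall_lt_top : linesUnitBall < ∞ := by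
  have hsub : {v : ℝ × ℝ × ℝ | (lineSlice (Metric.ball (1 : HeisK) 1) v).Nonempty} ∩
      Set.Ioc 0 (2 * Real.pi) ×ˢ (univ : Set (ℝ × ℝ)) ⊆
        Set.Ioc 0 (2 * Real.pi) ×ˢ (Ioo (-(1 : ℝ)) 1 ×ˢ Ioo (-(3 : ℝ)) 3) := by
    rintro ⟨θ, s, w⟩ ⟨hne, hθ, -⟩
    obtain ⟨hs, hw⟩ := param_bounds_of_lineSlice_unitBall_nonempty hne
    exact ⟨hθ, abs_lt.mp hs, abs_lt.mp hw⟩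
  rw [linesUnitBall, lineMeasure, Measure.restrict_apply' (measurableSet_Ioc.prod MeasurableSet.univ)]
  refine lt_of_le_of_lt (measure_mono hsub) ?_
  rw [Measure.volume_eq_prod, Measure.prod_prod, Measure.volume_eq_prod, Measure.prod_prod,
    Real.volume_Ioc, Real.volume_Ioo, Real.volume_Ioo]
  exact ENNReal.mul_lt_top ENNReal.ofReal_lt_top
    (ENNReal.mul_lt_top ENNReal.ofReal_lt_top ENNReal.ofReal_lt_top)

/-- The normalising factor of `NC_{B_r(x)}` is finite and non-zero for `r > 0`.
[cite: CheegerKleinerNaor2011, §4 (arXiv p. 13)] -/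
theorem normaliser_ne_zero {r : ℝ} (hr : 0 < r) : ENNReal.ofReal (r ^ 4) * linesUnitBall ≠ 0 :=
  mul_ne_zero (by rw [Ne, ENNReal.ofReal_eq_zero, not_le]; positivity) linesUnitBall_pos.ne'

/-- [cite: CheegerKleinerNaor2011, §4 (arXiv p. 13)] -/
theorem normaliser_ne_top (r : ℝ) : ENNReal.ofReal (r ^ 4) * linesUnitBall ≠ ∞ :=
  ENNReal.mul_ne_top ENNReal.ofReal_ne_top linesUnitBall_lt_top.ne

/-! ### Invariance under left translations and dilations ("scale invariant quantities") -/

/-- `NC` is invariant under translating the set and the window together.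
[cite: CheegerKleinerNaor2011, §4 (arXiv p. 13)] -/
theorem sliceNC_preimage_const_add (A T : Set ℝ) (τ : ℝ) :
    sliceNC ((fun t => τ + t) ⁻¹' A) ((fun t => τ + t) ⁻¹' T) = sliceNC A T := by
  have key : ∀ a b : ℝ, volume ((fun t => τ + t) ⁻¹' T ∩
      symmDiff ((fun t => τ + t) ⁻¹' A) (Ioo a b)) = volume (T ∩ symmDiff A (Ioo (τ + a) (τ + b))) := by
    intro a b
    have e : Ioo a b = (fun t => τ + t) ⁻¹' Ioo (τ + a) (τ + b) := by
      rw [Set.preimage_const_add_Ioo]; simp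
    rw [e, ← preimage_symmDiff', ← preimage_inter, measure_preimage_add]
  apply le_antisymm
  · refine le_iInf₂ fun a b => ?_
    have h := sliceNC_le ((fun t => τ + t) ⁻¹' A) ((fun t => τ + t) ⁻¹' T) (a - τ) (b - τ)
    rw [key] at h
    simpa using h
  · refine le_iInf₂ fun a b => ?_
    rw [key]
    exact sliceNC_le A T _ _

/-- `NM` is invariant under translating the set and the window together.
[cite: CheegerKleinerNaor2011, §4 (arXiv p. 13)] -/
theorem sliceNM_preimage_const_add (A T : Set ℝ) (τ : ℝ) :
    sliceNM ((fun t => τ + t) ⁻¹' A) ((fun t => τ + t) ⁻¹' T) = sliceNM A T := by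
  rw [sliceNM, sliceNM, ← Set.preimage_compl, sliceNC_preimage_const_add, sliceNC_preimage_const_add]

/-- `NC` scales like a length under dilating the set and the window together.
[cite: CheegerKleinerNaor2011, §4 (arXiv p. 13)] -/
theorem sliceNC_preimage_const_mul (A T : Set ℝ) {ρ : ℝ} (hρ : 0 < ρ) :
    sliceNC ((fun t => ρ * t) ⁻¹' A) ((fun t => ρ * t) ⁻¹' T) = ENNReal.ofReal ρ⁻¹ * sliceNC A T := by
  have key : ∀ a b : ℝ, volume ((fun t => ρ * t) ⁻¹' T ∩
      symmDiff ((fun t => ρ * t) ⁻¹' A) (Ioo a b)) =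
        ENNReal.ofReal ρ⁻¹ * volume (T ∩ symmDiff A (Ioo (ρ * a) (ρ * b))) := by
    intro a b
    have e : Ioo a b = (fun t => ρ * t) ⁻¹' Ioo (ρ * a) (ρ * b) := by
      ext t
      simp only [mem_Ioo, mem_preimage, mul_lt_mul_iff_right₀ hρ]
    rw [e, ← preimage_symmDiff', ← preimage_inter, Real.volume_preimage_mul_left hρ.ne',
      abs_of_pos (inv_pos.mpr hρ)]
  have hc0 : ENNReal.ofReal ρ⁻¹ ≠ 0 := by
    rw [Ne, ENNReal.ofReal_eq_zero, not_le]; exact inv_pos.mpr hρ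
  apply le_antisymm
  · rw [sliceNC, sliceNC, ENNReal.mul_iInf_of_ne hc0 ENNReal.ofReal_ne_top]
    refine le_iInf fun a => ?_
    rw [ENNReal.mul_iInf_of_ne hc0 ENNReal.ofReal_ne_top]
    refine le_iInf fun b => ?_
    have h := sliceNC_le ((fun t => ρ * t) ⁻¹' A) ((fun t => ρ * t) ⁻¹' T) (a / ρ) (b / ρ)
    rw [key, mul_div_cancel₀ _ hρ.ne', mul_div_cancel₀ _ hρ.ne'] at h
    exact h
  · refine le_iInf₂ fun a b => ?_
    rw [key]
    exact mul_le_mul_right (sliceNC_le A T _ _) _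

/-- [cite: CheegerKleinerNaor2011, §4 (arXiv p. 13)] -/
theorem sliceNM_preimage_const_mul (A T : Set ℝ) {ρ : ℝ} (hρ : 0 < ρ) :
    sliceNM ((fun t => ρ * t) ⁻¹' A) ((fun t => ρ * t) ⁻¹' T) = ENNReal.ofReal ρ⁻¹ * sliceNM A T := by
  rw [sliceNM, sliceNM, ← Set.preimage_compl, sliceNC_preimage_const_mul _ _ hρ,
    sliceNC_preimage_const_mul _ _ hρ, mul_add]

/-- The action of the left translation by `g` on line parameters `(θ, (s, w))`
(cf. `mul_lineMap`, `measurePreserving_lineParamShift`). [cite: CheegerKleinerNaor2011, §4 (arXiv p. 13)] -/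
def lineParamShift (g : HeisK) (v : ℝ × ℝ × ℝ) : ℝ × ℝ × ℝ :=
  (v.1, (v.2.1 + (-g.x * Real.sin v.1 + g.y * Real.cos v.1),
    v.2.2 + v.2.1 * (g.x * Real.cos v.1 + (g.x * Real.cos v.1 + g.y * Real.sin v.1) * Real.sin v.1 ^ 2) +
      (g.z - Real.cos v.1 * Real.sin v.1 * (g.x * Real.cos v.1 + g.y * Real.sin v.1) ^ 2 / 2 +
        (-g.x * Real.sin v.1 + g.y * Real.cos v.1) * (g.x * Real.cos v.1 + g.y * Real.sin v.1) *
          Real.sin v.1 ^ 2)))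

/-- The defining property of the parameter shift: `g · Λ_θ((s,w),t) = Λ_θ(shift, τ_g(θ) + t)`.
[cite: CheegerKleinerNaor2011, §4 (arXiv p. 13)] -/
theorem mul_lineMap_eq_lineMap_shift (g : HeisK) (v : ℝ × ℝ × ℝ) (t : ℝ) :
    g * lineMap v.1 (v.2, t) =
      lineMap v.1 ((lineParamShift g v).2, (g.x * Real.cos v.1 + g.y * Real.sin v.1) + t) := by
  obtain ⟨θ, s, w⟩ := v
  exact mul_lineMap g θ s w t

/-- [cite: CheegerKleinerNaor2011, §4 (arXiv p. 13)] -/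
@[simp] theorem lineParamShift_fst (g : HeisK) (v : ℝ × ℝ × ℝ) : (lineParamShift g v).1 = v.1 := rfl

/-- Shifting by `g⁻¹` undoes shifting by `g` (by the uniqueness of line parameters).
[cite: CheegerKleinerNaor2011, §4 (arXiv p. 13)] -/
theorem lineParamShift_inv_apply (g : HeisK) (v : ℝ × ℝ × ℝ) :
    lineParamShift g⁻¹ (lineParamShift g v) = v := by
  have h1 := mul_lineMap_eq_lineMap_shift g v 0
  have h2 := mul_lineMap_eq_lineMap_shift g⁻¹ (lineParamShift g v)
    ((g.x * Real.cos v.1 + g.y * Real.sin v.1) + 0)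
  simp only [lineParamShift_fst] at h2
  rw [← h1, inv_mul_cancel_left] at h2
  -- `h2 : Λ_θ(v.2, 0) = Λ_θ((shift g⁻¹ (shift g v)).2, τ' + (τ + 0))`
  have hinj := (lineEquiv v.1).injective
    (show lineEquiv v.1 (v.2, (0 : ℝ)) = lineEquiv v.1
      ((lineParamShift g⁻¹ (lineParamShift g v)).2,
        (g⁻¹.x * Real.cos v.1 + g⁻¹.y * Real.sin v.1) +
          ((g.x * Real.cos v.1 + g.y * Real.sin v.1) + 0)) from h2)
  have h2' := (Prod.ext_iff.mp hinj).1
  obtain ⟨θ, sw⟩ := v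
  simp only at h2'
  exact Prod.ext rfl h2'.symm

/-- The parameter shift as a measurable equivalence of `ℝ³`. [cite: CheegerKleinerNaor2011, §4 (arXiv p. 13)] -/
def lineParamShiftEquiv (g : HeisK) : (ℝ × ℝ × ℝ) ≃ᵐ (ℝ × ℝ × ℝ) where
  toFun := lineParamShift g
  invFun := lineParamShift g⁻¹
  left_inv := lineParamShift_inv_apply g
  right_inv v := by simpa using lineParamShift_inv_apply g⁻¹ v
  measurable_toFun := by
    show Measurable (lineParamShift g)
    unfold lineParamShift; fun_prop
  measurable_invFun := by
    show Measurable (lineParamShift g⁻¹)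
    unfold lineParamShift; fun_prop

/-- The parameter shift preserves the measure on lines `𝒩' = dθ ds dw|_{θ ∈ (0,2π]}`.
[cite: CheegerKleinerNaor2011, §4 (arXiv p. 13)] -/
theorem measurePreserving_lineParamShift_lineMeasure (g : HeisK) :
    MeasurePreserving (lineParamShift g) lineMeasure lineMeasure := by
  have h0 : MeasurePreserving (lineParamShift g) (volume : Measure (ℝ × (ℝ × ℝ))) volume :=
    measurePreserving_lineParamShift g
  have h := h0.restrict_preimage
    (measurableSet_Ioc.prod MeasurableSet.univ : MeasurableSet
      (Set.Ioc (0 : ℝ) (2 * Real.pi) ×ˢ (univ : Set (ℝ × ℝ))))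
  have e : lineParamShift g ⁻¹' (Set.Ioc (0 : ℝ) (2 * Real.pi) ×ˢ (univ : Set (ℝ × ℝ))) =
      Set.Ioc (0 : ℝ) (2 * Real.pi) ×ˢ (univ : Set (ℝ × ℝ)) := by
    ext v; simp [lineParamShift]
  rw [e] at h
  exact h

/-- Nonconvexity along a line of a left translate: `NC_{B_r(x)}(g⁻¹E, L) = NC_{B_r(gx)}(E, gL)`.
[cite: CheegerKleinerNaor2011, §4 (arXiv p. 13)] -/
theorem lineNC_preimage_mul (g : HeisK) (E : Set HeisK) (x : HeisK) (r : ℝ) (v : ℝ × ℝ × ℝ) :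
    lineNC ((fun p => g * p) ⁻¹' E) x r v = lineNC E (g * x) r (lineParamShift g v) := by
  obtain ⟨θ, s, w⟩ := v
  have hball : Metric.ball x r = (fun p => g * p) ⁻¹' Metric.ball (g * x) r := by
    ext p; simp [Metric.mem_ball, dist_mul_left]
  rw [lineNC, lineNC, hball, lineSlice_preimage_mul, lineSlice_preimage_mul, sliceNC_preimage_const_add]
  rfl

/-- **Left-invariance of the total nonconvexity**: `NC_{B_r(x)}(g⁻¹E) = NC_{B_r(gx)}(E)`
(change of variables in the left-invariant measure `𝒩`). [cite: CheegerKleinerNaor2011, §4 (arXiv p. 13)] -/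
theorem totalNC_preimage_mul (g : HeisK) (E : Set HeisK) (x : HeisK) (r : ℝ) :
    totalNC ((fun p => g * p) ⁻¹' E) x r = totalNC E (g * x) r := by
  rw [totalNC, totalNC]
  congr 1
  simp_rw [lineNC_preimage_mul]
  exact (measurePreserving_lineParamShift_lineMeasure g).lintegral_comp_emb
    (lineParamShiftEquiv g).measurableEmbedding _

/-- **Left-invariance of the total nonmonotonicity**: `NM_{B_r(x)}(g⁻¹E) = NM_{B_r(gx)}(E)`.
[cite: CheegerKleinerNaor2011, §4 (arXiv p. 13)] -/
theorem totalNM_preimage_mul (g : HeisK) (E : Set HeisK) (x : HeisK) (r : ℝ) :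
    totalNM ((fun p => g * p) ⁻¹' E) x r = totalNM E (g * x) r := by
  rw [totalNM, totalNM, ← Set.preimage_compl, totalNC_preimage_mul, totalNC_preimage_mul]

/-- `δ`-monotonicity is left-invariant. [cite: CheegerKleinerNaor2011, §4 Def. 18 (arXiv p. 13)] -/
theorem isDeltaMonotone_preimage_mul_iff (g : HeisK) (E : Set HeisK) (x : HeisK) (r δ : ℝ) :
    IsDeltaMonotone ((fun p => g * p) ⁻¹' E) x r δ ↔ IsDeltaMonotone E (g * x) r δ := by
  rw [IsDeltaMonotone, IsDeltaMonotone, totalNM_preimage_mul]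

/-- The action of the dilation `δ_ρ` on line parameters: `(θ, s, w) ↦ (θ, ρs, ρ²w)`
(cf. `dilate_lineMap`). [cite: CheegerKleinerNaor2011, §1.1] -/
def lineParamDilate (ρ : ℝ) (v : ℝ × ℝ × ℝ) : ℝ × ℝ × ℝ := (v.1, (ρ * v.2.1, ρ ^ 2 * v.2.2))

/-- The parameter dilation as a measurable equivalence (`ρ ≠ 0`). [cite: CheegerKleinerNaor2011, §1.1] -/
def lineParamDilateEquiv {ρ : ℝ} (hρ : ρ ≠ 0) : (ℝ × ℝ × ℝ) ≃ᵐ (ℝ × ℝ × ℝ) where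
  toFun := lineParamDilate ρ
  invFun := lineParamDilate ρ⁻¹
  left_inv v := by
    obtain ⟨θ, s, w⟩ := v
    simp only [lineParamDilate, Prod.mk.injEq]
    exact ⟨trivial, by field_simp, by field_simp⟩
  right_inv v := by
    obtain ⟨θ, s, w⟩ := v
    simp only [lineParamDilate, Prod.mk.injEq]
    exact ⟨trivial, by field_simp, by field_simp⟩
  measurable_toFun := by
    show Measurable (lineParamDilate ρ)
    unfold lineParamDilate; fun_prop
  measurable_invFun := by
    show Measurable (lineParamDilate ρ⁻¹)
    unfold lineParamDilate; fun_prop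

/-- The parameter dilation scales the measure on lines by `ρ⁻³`:
`(δ_ρ)_* 𝒩' = ρ⁻³ 𝒩'` (`ρ > 0`). [cite: CheegerKleinerNaor2011, §1.1] -/
theorem map_lineParamDilate_lineMeasure {ρ : ℝ} (hρ : 0 < ρ) :
    Measure.map (lineParamDilate ρ) lineMeasure = ENNReal.ofReal (ρ⁻¹ ^ 3) • lineMeasure := by
  have hρ0 : ρ ≠ 0 := hρ.ne'
  have hρ2 : ρ ^ 2 ≠ 0 := pow_ne_zero 2 hρ0
  -- the map on all of `ℝ³`
  have hvol : Measure.map (lineParamDilate ρ) (volume : Measure (ℝ × ℝ × ℝ)) =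
      ENNReal.ofReal (ρ⁻¹ ^ 3) • volume := by
    have h1 : MeasurePreserving (fun a : ℝ => ρ * a) volume (ENNReal.ofReal |ρ⁻¹| • volume) :=
      ⟨measurable_const_mul ρ, Real.map_volume_mul_left hρ0⟩
    have h2 : MeasurePreserving (fun a : ℝ => ρ ^ 2 * a) volume
        (ENNReal.ofReal |(ρ ^ 2)⁻¹| • volume) :=
      ⟨measurable_const_mul _, Real.map_volume_mul_left hρ2⟩
    have h := (MeasurePreserving.id (volume : Measure ℝ)).prod (h1.prod h2)
    have e : lineParamDilate ρ = Prod.map id (Prod.map (fun a : ℝ => ρ * a) (fun a : ℝ => ρ ^ 2 * a)) := rfl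
    rw [e, Measure.volume_eq_prod, Measure.volume_eq_prod, h.map_eq, Measure.prod_smul_left,
      Measure.prod_smul_right, Measure.prod_smul_right, Measure.prod_smul_right, smul_smul]
    congr 1
    rw [abs_of_pos (inv_pos.mpr hρ), abs_of_pos (by positivity), ← ENNReal.ofReal_mul (by positivity)]
    congr 1
    field_simp
  have hmeas : Measurable (lineParamDilate ρ) := by unfold lineParamDilate; fun_prop
  have hS : MeasurableSet (Set.Ioc (0 : ℝ) (2 * Real.pi) ×ˢ (univ : Set (ℝ × ℝ))) :=
    measurableSet_Ioc.prod MeasurableSet.univ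
  have e : lineParamDilate ρ ⁻¹' (Set.Ioc (0 : ℝ) (2 * Real.pi) ×ˢ (univ : Set (ℝ × ℝ))) =
      Set.Ioc (0 : ℝ) (2 * Real.pi) ×ˢ (univ : Set (ℝ × ℝ)) := by
    ext v; simp [lineParamDilate]
  rw [lineMeasure, ← e, ← Measure.restrict_map hmeas hS, hvol, Measure.restrict_smul, e]

/-- `δ_ρ⁻¹ B_{ρr}(δ_ρ x) = B_r(x)`. [cite: CheegerKleinerNaor2011, §1.1] -/
theorem preimage_dilate_ball' {ρ : ℝ} (hρ : 0 < ρ) (x : HeisK) (r : ℝ) :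
    dilate ρ ⁻¹' Metric.ball (dilate ρ x) (ρ * r) = Metric.ball x r := by
  ext p
  simp only [mem_preimage, Metric.mem_ball]
  rw [dist_dilate, abs_of_pos hρ]
  exact mul_lt_mul_iff_right₀ hρ

/-- Slices of dilates: `{t | Λ_θ((s,w),t) ∈ δ_ρ⁻¹E}` is the `ρ`-rescaling of a slice of `E`.
[cite: CheegerKleinerNaor2011, §1.1] -/
theorem lineSlice_preimage_dilate (ρ : ℝ) (E : Set HeisK) (v : ℝ × ℝ × ℝ) :
    lineSlice (dilate ρ ⁻¹' E) v = (fun t => ρ * t) ⁻¹' lineSlice E (lineParamDilate ρ v) := by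
  obtain ⟨θ, s, w⟩ := v
  ext t
  simp only [mem_lineSlice, mem_preimage, lineParamDilate]
  rw [dilate_lineMap]

/-- Nonconvexity along a line of a dilate: `NC_{B_r(x)}(δ_ρ⁻¹E, L) = ρ⁻¹ NC_{B_{ρr}(δ_ρ x)}(E, δ_ρ L)`.
[cite: CheegerKleinerNaor2011, §4 (arXiv p. 13)] -/
theorem lineNC_preimage_dilate {ρ : ℝ} (hρ : 0 < ρ) (E : Set HeisK) (x : HeisK) (r : ℝ)
    (v : ℝ × ℝ × ℝ) :
    lineNC (dilate ρ ⁻¹' E) x r v =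
      ENNReal.ofReal ρ⁻¹ * lineNC E (dilate ρ x) (ρ * r) (lineParamDilate ρ v) := by
  rw [lineNC, lineNC, ← preimage_dilate_ball' hρ x r, lineSlice_preimage_dilate,
    lineSlice_preimage_dilate, sliceNC_preimage_const_mul _ _ hρ]

/-- The normalising factors at scales `r` and `ρr`: `((ρr)⁴ κ)⁻¹ = ρ⁻⁴ (r⁴ κ)⁻¹`.
[cite: CheegerKleinerNaor2011, §4 (arXiv p. 13)] -/
theorem normaliser_dilate {ρ : ℝ} (hρ : 0 < ρ) (r : ℝ) :
    (ENNReal.ofReal ((ρ * r) ^ 4) * linesUnitBall)⁻¹ =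
      ENNReal.ofReal (ρ⁻¹ ^ 4) * (ENNReal.ofReal (r ^ 4) * linesUnitBall)⁻¹ := by
  have h0 : ENNReal.ofReal (ρ ^ 4) ≠ 0 := by
    rw [Ne, ENNReal.ofReal_eq_zero, not_le]; positivity
  rw [mul_pow, ENNReal.ofReal_mul (by positivity), mul_assoc,
    ENNReal.mul_inv (Or.inl h0) (Or.inl ENNReal.ofReal_ne_top),
    ← ENNReal.ofReal_inv_of_pos (by positivity : (0 : ℝ) < ρ ^ 4), inv_pow]

/-- **Scale invariance of the total nonconvexity**: `NC_{B_r(x)}(δ_ρ⁻¹E) = NC_{B_{ρr}(δ_ρ x)}(E)`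
("the following (scale invariant) quantities", [CKN §4]: the factor `r⁻⁴` exactly compensates
`𝒩`'s scaling `ρ³` and the length scaling `ρ`). [cite: CheegerKleinerNaor2011, §4 (arXiv p. 13)] -/
theorem totalNC_preimage_dilate {ρ : ℝ} (hρ : 0 < ρ) (E : Set HeisK) (x : HeisK) (r : ℝ) :
    totalNC (dilate ρ ⁻¹' E) x r = totalNC E (dilate ρ x) (ρ * r) := by
  have hρ0 : ρ ≠ 0 := hρ.ne'
  rw [totalNC, totalNC]
  simp_rw [lineNC_preimage_dilate hρ]
  rw [lintegral_const_mul' _ _ ENNReal.ofReal_ne_top]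
  -- change of variables `v ↦ δ_ρ v` in `𝒩'`
  have hcv : ∫⁻ v, lineNC E (dilate ρ x) (ρ * r) (lineParamDilate ρ v) ∂lineMeasure =
      ENNReal.ofReal (ρ⁻¹ ^ 3) * ∫⁻ v, lineNC E (dilate ρ x) (ρ * r) v ∂lineMeasure := by
    have h := MeasureTheory.lintegral_map_equiv (μ := lineMeasure)
      (lineNC E (dilate ρ x) (ρ * r)) (lineParamDilateEquiv hρ0)
    have e : ⇑(lineParamDilateEquiv hρ0) = lineParamDilate ρ := rfl
    rw [e, map_lineParamDilate_lineMeasure hρ, lintegral_smul_measure] at h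
    exact h.symm
  rw [hcv, ← mul_assoc, ← mul_assoc]
  congr 1
  -- the constants: `(r⁴ κ)⁻¹ ρ⁻¹ ρ⁻³ = ((ρr)⁴ κ)⁻¹`
  rw [normaliser_dilate hρ r, mul_assoc, ← ENNReal.ofReal_mul (by positivity),
    show ρ⁻¹ * ρ⁻¹ ^ 3 = ρ⁻¹ ^ 4 by ring, mul_comm]

/-- **Scale invariance of the total nonmonotonicity**. [cite: CheegerKleinerNaor2011, §4 (arXiv p. 13)] -/
theorem totalNM_preimage_dilate {ρ : ℝ} (hρ : 0 < ρ) (E : Set HeisK) (x : HeisK) (r : ℝ) :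
    totalNM (dilate ρ ⁻¹' E) x r = totalNM E (dilate ρ x) (ρ * r) := by
  rw [totalNM, totalNM, ← Set.preimage_compl, totalNC_preimage_dilate hρ, totalNC_preimage_dilate hρ]

/-- `δ`-monotonicity is scale invariant. [cite: CheegerKleinerNaor2011, §4 Def. 18 (arXiv p. 13)] -/
theorem isDeltaMonotone_preimage_dilate_iff {ρ : ℝ} (hρ : 0 < ρ) (E : Set HeisK) (x : HeisK) (r δ : ℝ) :
    IsDeltaMonotone (dilate ρ ⁻¹' E) x r δ ↔ IsDeltaMonotone E (dilate ρ x) (ρ * r) δ := by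
  rw [IsDeltaMonotone, IsDeltaMonotone, totalNM_preimage_dilate hρ]

end HeisK

end Literature.Geometry.MetricEmbeddings

end
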